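import Summits.QuantumFields.YangMills.Theorems.ColdStartUniversalityColdStartSolutionsExistCoordMartingale
import Literature.Probability.Process.SimpleIntegralMartingale
import HarnessLib

/-!
# Route `ColdStartUniversality`, support item S (stmt-QuantumFields-24811), line `piwiener`:
# stub B tools II — second moments of martingale-difference sums built from Brownian-vector increments

Helper file (lead `ym-line-csu-p1`) for stub B1 `stub_tangentSumSq` (quadratic-variation step of the
sphere-preservation argument).  For a Brownian vector `W` (tree `IsBrownianVec`, joint raw filtration
`𝓕`), a monotone grid `u : ℕ → ℝ≥0`, bounded `𝓕_{u_j}`-measurable weights `ξ_j` (`|ξ_j| ≤ C`) and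
centred functionals `g_j` of the increment `Δ_j = W_{u_{j+1}} − W_{u_j}` (`∫ g_j dN(0, h_j I) = 0`,
`h_j = u_{j+1} − u_j`):

  `E[(Σ_{j<M} ξ_j g_j(Δ_j))²] ≤ C² Σ_{j<M} ∫ g_j² dN(0, h_j I)`   (`gaussSum_sq_le`),

by orthogonality of the summands (the increment after `u_j` is independent of `𝓕_{u_j}`).  Specialised:
`gaussSum_cross_sq_le` (`g = x_p x_q`, `p ≠ q`: bound `C² Σ h_j²`) and `gaussSum_compSq_sq_le`
(`g = x_p² − h`: bound `(m₄ − 1) C² Σ h_j²`, `m₄` the tree's `gaussFourthMoment`).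

No definition, no sorry.  RECORD-rung plumbing; nothing here bears on the Yang–Mills mass gap. -/

set_option autoImplicit false

noncomputable section

namespace Summit.QuantumFields.YangMills.Theorems.ColdStartUniversality

open MeasureTheory ProbabilityTheory Filter Topology Finset
open scoped NNReal ENNReal BigOperators
open Literature.Probability.Process

variable {Ω : Type*} {mΩ : MeasurableSpace Ω} {P : Measure Ω} {d : ℕ} {W : ℝ≥0 → Ω → (Fin d → ℝ)}

/-- **Factorisation against an increment after `s`**: for `F` `𝓕_s`-measurable and `g` Borel,
`E[F · g(W_{s+h} − W_s)] = E[F] · ∫ g dN(0, hI)` (weak Markov property + Gaussian increments). [folklore] -/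
theorem integral_mul_comp_incr [IsProbabilityMeasure P] (hW : IsBrownianVec W P) {s h : ℝ≥0}
    {F : Ω → ℝ} (hF : Measurable[hW.natFiltration s] F) {g : (Fin d → ℝ) → ℝ} (hg : Measurable g) :
    ∫ ω, F ω * g (W (s + h) ω - W s ω) ∂P = (∫ ω, F ω ∂P) * ∫ x, g x ∂gaussVec d h := by
  have hFm : Measurable F := hF.mono (hW.natFiltration.le s) le_rfl
  have hΔ : Measurable fun ω => W (s + h) ω - W s ω := (hW.measurable _).sub (hW.measurable _)
  have hind : IndepFun F (fun ω => W (s + h) ω - W s ω) P := by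
    rw [IndepFun_iff_Indep]
    exact indep_of_indep_of_le_right (indep_of_indep_of_le_left
      (hW.indep_comap_vecShift_natFiltration s).symm hF.comap_le) (IsBrownianVec.measurable_incr_comap s h).comap_le
  have hind' : IndepFun F (fun ω => g (W (s + h) ω - W s ω)) P := hind.comp measurable_id hg
  rw [hind'.integral_fun_mul_eq_mul_integral hFm.aestronglyMeasurable (hg.comp hΔ).aestronglyMeasurable]
  congr 1
  rw [← hW.map_incr s h, integral_map hΔ.aemeasurable hg.aestronglyMeasurable]

/-- `L²` transfer from the Gaussian law: if `g²` is integrable for `N(0, hI)` then `g(W_{s+h} − W_s) ∈ L²`.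
[folklore] -/
theorem memLp_two_comp_incr [IsProbabilityMeasure P] (hW : IsBrownianVec W P) {s h : ℝ≥0}
    {g : (Fin d → ℝ) → ℝ} (hg : Measurable g) (hg2 : Integrable (fun x => g x ^ 2) (gaussVec d h)) :
    MemLp (fun ω => g (W (s + h) ω - W s ω)) 2 P := by
  have hΔ : Measurable fun ω => W (s + h) ω - W s ω := (hW.measurable _).sub (hW.measurable _)
  have hsm : AEStronglyMeasurable (fun ω => g (W (s + h) ω - W s ω)) P := (hg.comp hΔ).aestronglyMeasurable
  rw [memLp_two_iff_integrable_sq hsm]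
  have h := (integrable_map_measure (μ := P) (f := fun ω => W (s + h) ω - W s ω) (g := fun x => g x ^ 2)
    ((hg.pow_const 2).aestronglyMeasurable) hΔ.aemeasurable).1 (by rw [hW.map_incr s h]; exact hg2)
  exact h

/-- **Second moment of a martingale-difference sum over Brownian increments.**  For a monotone grid `u`,
bounded `𝓕_{u_j}`-measurable weights `ξ_j` (`|ξ_j| ≤ C`), and Borel `g_j` with `∫ g_j dN(0, h_jI) = 0` and
`g_j²` integrable (`h_j = u_{j+1} − u_j`): the sum `S_M = Σ_{j<M} ξ_j g_j(W_{u_{j+1}} − W_{u_j})` is in `L²`,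
`𝓕_{u_M}`-measurable, and `E[S_M²] ≤ C² Σ_{j<M} ∫ g_j² dN(0, h_jI)`. [folklore] -/
theorem gaussSum_sq_le [IsProbabilityMeasure P] (hW : IsBrownianVec W P) {u : ℕ → ℝ≥0} (hu : Monotone u)
    {ξ : ℕ → Ω → ℝ} (hξ : ∀ j, Measurable[hW.natFiltration (u j)] (ξ j)) {C : ℝ} (hC : ∀ j ω, |ξ j ω| ≤ C)
    {g : ℕ → (Fin d → ℝ) → ℝ} (hg : ∀ j, Measurable (g j))
    (hg0 : ∀ j, ∫ x, g j x ∂gaussVec d (u (j + 1) - u j) = 0)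
    (hg2 : ∀ j, Integrable (fun x => g j x ^ 2) (gaussVec d (u (j + 1) - u j))) (M : ℕ) :
    MemLp (fun ω => ∑ j ∈ range M, ξ j ω * g j (W (u (j + 1)) ω - W (u j) ω)) 2 P ∧
      Measurable[hW.natFiltration (u M)] (fun ω => ∑ j ∈ range M, ξ j ω * g j (W (u (j + 1)) ω - W (u j) ω)) ∧
      ∫ ω, (∑ j ∈ range M, ξ j ω * g j (W (u (j + 1)) ω - W (u j) ω)) ^ 2 ∂P ≤
        C ^ 2 * ∑ j ∈ range M, ∫ x, g j x ^ 2 ∂gaussVec d (u (j + 1) - u j) := by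
  have hincr : ∀ j, u (j + 1) = u j + (u (j + 1) - u j) := fun j => (add_tsub_cancel_of_le (hu (Nat.le_succ j))).symm
  have hξm : ∀ j, Measurable (ξ j) := fun j => (hξ j).mono (hW.natFiltration.le _) le_rfl
  -- the summands
  have hA2 : ∀ j, MemLp (fun ω => ξ j ω * g j (W (u (j + 1)) ω - W (u j) ω)) 2 P := by
    intro j
    have h := memLp_two_comp_incr hW (s := u j) (h := u (j + 1) - u j) (hg j) (hg2 j)
    rw [← hincr j] at h
    exact memLp_two_bdd_mul (hξm j).aestronglyMeasurable (hC j) h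
  have hAm : ∀ j, Measurable[hW.natFiltration (u (j + 1))] (fun ω => ξ j ω * g j (W (u (j + 1)) ω - W (u j) ω)) := by
    intro j
    have h1 : Measurable[hW.natFiltration (u (j + 1))] (ξ j) :=
      (hξ j).mono (hW.natFiltration.mono (hu (Nat.le_succ j))) le_rfl
    have h2 : Measurable[hW.natFiltration (u (j + 1))] fun ω => W (u (j + 1)) ω - W (u j) ω :=
      (hW.measurable_apply_le le_rfl).sub (hW.measurable_apply_le (hu (Nat.le_succ j)))
    exact h1.mul ((hg j).comp h2)
  induction M with
  | zero =>
    simp only [Finset.range_zero, Finset.sum_empty]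
    exact ⟨MemLp.zero, measurable_const, by simp⟩
  | succ M ih =>
    obtain ⟨hS2, hSm, hSle⟩ := ih
    have hSm' : Measurable[hW.natFiltration (u (M + 1))]
        (fun ω => ∑ j ∈ range M, ξ j ω * g j (W (u (j + 1)) ω - W (u j) ω)) :=
      hSm.mono (hW.natFiltration.mono (hu (Nat.le_succ M))) le_rfl
    refine ⟨?_, ?_, ?_⟩
    · simp_rw [Finset.sum_range_succ]
      exact hS2.add (hA2 M)
    · simp_rw [Finset.sum_range_succ]
      exact hSm'.add (hAm M)
    · -- orthogonality: `E[S_M · A_M] = 0`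
      have horth : ∫ ω, (∑ j ∈ range M, ξ j ω * g j (W (u (j + 1)) ω - W (u j) ω)) *
          (ξ M ω * g M (W (u (M + 1)) ω - W (u M) ω)) ∂P = 0 := by
        have h := integral_mul_comp_incr hW (s := u M) (h := u (M + 1) - u M)
          (F := fun ω => (∑ j ∈ range M, ξ j ω * g j (W (u (j + 1)) ω - W (u j) ω)) * ξ M ω)
          (hSm.mul (hξ M)) (hg M)
        rw [← hincr M, hg0 M, mul_zero] at h
        simpa [mul_assoc] using h
      -- the square of the last summand: `E[A_M²] ≤ C² m_M`
      have hlast : ∫ ω, (ξ M ω * g M (W (u (M + 1)) ω - W (u M) ω)) ^ 2 ∂P ≤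
          C ^ 2 * ∫ x, g M x ^ 2 ∂gaussVec d (u (M + 1) - u M) := by
        have h := integral_mul_comp_incr hW (s := u M) (h := u (M + 1) - u M) (F := fun ω => ξ M ω ^ 2)
          ((hξ M).pow_const 2) ((hg M).pow_const 2)
        rw [← hincr M] at h
        have heq : ∀ ω, (ξ M ω * g M (W (u (M + 1)) ω - W (u M) ω)) ^ 2 =
            ξ M ω ^ 2 * g M (W (u (M + 1)) ω - W (u M) ω) ^ 2 := fun ω => by ring
        simp_rw [heq]
        rw [h]
        refine mul_le_mul_of_nonneg_right ?_ (integral_nonneg fun x => sq_nonneg _)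
        calc ∫ ω, ξ M ω ^ 2 ∂P ≤ ∫ _ω, C ^ 2 ∂P := by
              refine integral_mono_of_nonneg (ae_of_all _ fun ω => sq_nonneg _) (integrable_const _)
                (ae_of_all _ fun ω => ?_)
              have h1 : |ξ M ω| ^ 2 ≤ C ^ 2 := pow_le_pow_left₀ (abs_nonneg _) (hC M ω) 2
              simpa only [sq_abs] using h1
          _ = C ^ 2 := by simp
      -- expand the square
      have hB : Integrable (fun ω => (∑ j ∈ range M, ξ j ω * g j (W (u (j + 1)) ω - W (u j) ω)) *
          (ξ M ω * g M (W (u (M + 1)) ω - W (u M) ω))) P := hS2.integrable_mul (hA2 M)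
      have hB2 : Integrable (fun ω => 2 * ((∑ j ∈ range M, ξ j ω * g j (W (u (j + 1)) ω - W (u j) ω)) *
          (ξ M ω * g M (W (u (M + 1)) ω - W (u M) ω)))) P := hB.const_mul 2
      have hAsq : Integrable (fun ω => (ξ M ω * g M (W (u (M + 1)) ω - W (u M) ω)) ^ 2) P := (hA2 M).integrable_sq
      have hSsq : Integrable (fun ω => (∑ j ∈ range M, ξ j ω * g j (W (u (j + 1)) ω - W (u j) ω)) ^ 2) P :=
        hS2.integrable_sq
      have hSB : Integrable (fun ω => (∑ j ∈ range M, ξ j ω * g j (W (u (j + 1)) ω - W (u j) ω)) ^ 2 +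
          2 * ((∑ j ∈ range M, ξ j ω * g j (W (u (j + 1)) ω - W (u j) ω)) *
            (ξ M ω * g M (W (u (M + 1)) ω - W (u M) ω)))) P := hSsq.add hB2
      have hexp : ∀ ω, (∑ j ∈ range (M + 1), ξ j ω * g j (W (u (j + 1)) ω - W (u j) ω)) ^ 2 =
          (∑ j ∈ range M, ξ j ω * g j (W (u (j + 1)) ω - W (u j) ω)) ^ 2 +
            2 * ((∑ j ∈ range M, ξ j ω * g j (W (u (j + 1)) ω - W (u j) ω)) *
              (ξ M ω * g M (W (u (M + 1)) ω - W (u M) ω))) +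
            (ξ M ω * g M (W (u (M + 1)) ω - W (u M) ω)) ^ 2 := by
        intro ω; rw [Finset.sum_range_succ]; ring
      simp_rw [hexp]
      rw [integral_add hSB hAsq, integral_add hSsq hB2, integral_const_mul, horth, Finset.sum_range_succ, mul_add]
      linarith

/-- `∫ (x_p x_q)² dN(0, hI) = h²` for `p ≠ q`. [folklore] -/
theorem gaussVec_integral_mul_sq_of_ne {p q : Fin d} (hpq : p ≠ q) (h : ℝ≥0) :
    ∫ x, (x p * x q) ^ 2 ∂gaussVec d h = (h : ℝ) ^ 2 := by
  classical
  set gg : Fin d → ℝ → ℝ := fun k y => if k = p ∨ k = q then y ^ 2 else 1 with hgg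
  have hprod : ∀ x : Fin d → ℝ, ∏ k, gg k (x k) = (x p * x q) ^ 2 := by
    intro x
    rw [← Finset.prod_filter_mul_prod_filter_not Finset.univ (fun k => k = p ∨ k = q)]
    have h2 : (Finset.univ.filter fun k => ¬(k = p ∨ k = q)).prod (fun k => gg k (x k)) = 1 :=
      Finset.prod_eq_one fun k hk => by
        simp only [Finset.mem_filter, Finset.mem_univ, true_and] at hk
        simp [hgg, hk]
    have h1 : (Finset.univ.filter fun k => k = p ∨ k = q) = {p, q} := by ext k; simp
    rw [h2, mul_one, h1, Finset.prod_pair hpq]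
    simp [hgg]
    ring
  simp_rw [← hprod]
  rw [gaussVec, integral_fintype_prod_eq_prod]
  have hk : ∀ k, ∫ y, gg k y ∂gaussianReal 0 h = if k = p ∨ k = q then (h : ℝ) else 1 := by
    intro k
    by_cases hk : k = p ∨ k = q
    · simp only [hgg, hk, if_true]
      have hv := variance_of_integral_eq_zero (μ := gaussianReal 0 h) (X := id) measurable_id.aemeasurable
        (by simp [integral_id_gaussianReal])
      rw [variance_id_gaussianReal] at hv
      simpa using hv.symm
    · simp [hgg, hk]
  simp_rw [hk]
  rw [← Finset.prod_filter_mul_prod_filter_not Finset.univ (fun k => k = p ∨ k = q)]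
  have h1 : (Finset.univ.filter fun k => k = p ∨ k = q) = {p, q} := by ext k; simp
  rw [h1, Finset.prod_pair hpq, Finset.prod_eq_one fun k hk => ?_]
  · simp [sq]
  · simp only [Finset.mem_filter, Finset.mem_univ, true_and] at hk
    simp [hk]

/-- `∫ (x_p² − h)² dN(0, hI) = (m₄ − 1) h²` with `m₄ = gaussFourthMoment`. [folklore] -/
theorem gaussVec_integral_compSq_sq (p : Fin d) (h : ℝ≥0) :
    ∫ x, (x p ^ 2 - h) ^ 2 ∂gaussVec d h = (gaussFourthMoment - 1) * (h : ℝ) ^ 2 := by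
  have heq : ∀ x : Fin d → ℝ, (x p ^ 2 - h) ^ 2 = x p ^ 4 - 2 * h * x p ^ 2 + (h : ℝ) ^ 2 := fun x => by ring
  simp_rw [heq]
  have h4 : Integrable (fun x : Fin d → ℝ => x p ^ 4) (gaussVec d h) := gaussVec_integrable_pow (d := d) (h := h) p 4
  have h2 : Integrable (fun x : Fin d → ℝ => 2 * h * x p ^ 2) (gaussVec d h) :=
    (gaussVec_integrable_pow (d := d) (h := h) p 2).const_mul _
  have h42 : Integrable (fun x : Fin d → ℝ => x p ^ 4 - 2 * h * x p ^ 2) (gaussVec d h) := h4.sub h2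
  rw [integral_add h42 (integrable_const _), integral_sub h4 h2, integral_const_mul, gaussVec_integral_pow_four,
    gaussVec_integral_sq, integral_const]
  simp
  ring

/-- **Cross increments** (`p ≠ q`): `E[(Σ_{j<M} ξ_j Δ_jW^p Δ_jW^q)²] ≤ C² Σ_{j<M} h_j²`, and the sum is in `L²`.
[folklore] -/
theorem gaussSum_cross_sq_le [IsProbabilityMeasure P] (hW : IsBrownianVec W P) {u : ℕ → ℝ≥0}
    (hu : Monotone u) {ξ : ℕ → Ω → ℝ} (hξ : ∀ j, Measurable[hW.natFiltration (u j)] (ξ j)) {C : ℝ}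
    (hC : ∀ j ω, |ξ j ω| ≤ C) {p q : Fin d} (hpq : p ≠ q) (M : ℕ) :
    MemLp (fun ω => ∑ j ∈ range M, ξ j ω * (fun x : Fin d → ℝ => x p * x q) (W (u (j + 1)) ω - W (u j) ω)) 2 P ∧
      ∫ ω, (∑ j ∈ range M, ξ j ω * (fun x : Fin d → ℝ => x p * x q) (W (u (j + 1)) ω - W (u j) ω)) ^ 2 ∂P ≤
        C ^ 2 * ∑ j ∈ range M, ((u (j + 1) : ℝ) - u j) ^ 2 := by
  have hg : ∀ _j : ℕ, Measurable fun x : Fin d → ℝ => x p * x q := fun _ =>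
    (measurable_pi_apply p).mul (measurable_pi_apply q)
  have hg0 : ∀ j, ∫ x, (fun (_ : ℕ) (x : Fin d → ℝ) => x p * x q) j x ∂gaussVec d (u (j + 1) - u j) = 0 :=
    fun j => gaussVec_integral_mul_of_ne hpq
  have hg2 : ∀ j, Integrable (fun x => (fun (_ : ℕ) (x : Fin d → ℝ) => x p * x q) j x ^ 2)
      (gaussVec d (u (j + 1) - u j)) := by
    intro j
    have h4 := (gaussVec_integrable_pow (d := d) (h := u (j + 1) - u j) p 4).add
      (gaussVec_integrable_pow (d := d) (h := u (j + 1) - u j) q 4)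
    refine h4.mono' (((hg j).pow_const 2).aestronglyMeasurable) (ae_of_all _ fun x => ?_)
    simp only [Real.norm_eq_abs, Pi.add_apply]
    rw [abs_of_nonneg (sq_nonneg _)]
    nlinarith [sq_nonneg (x p ^ 2 - x q ^ 2), sq_nonneg (x p), sq_nonneg (x q)]
  obtain ⟨h1, -, h3⟩ := gaussSum_sq_le hW hu hξ hC hg hg0 hg2 M
  refine ⟨h1, h3.trans_eq ?_⟩
  congr 1
  refine Finset.sum_congr rfl fun j _ => ?_
  rw [gaussVec_integral_mul_sq_of_ne hpq, NNReal.coe_sub (hu (Nat.le_succ j))]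

/-- **Compensated squared increments**: `E[(Σ_{j<M} ξ_j ((Δ_jW^p)² − h_j))²] ≤ (m₄ − 1) C² Σ_{j<M} h_j²`, and
the sum is in `L²`. [folklore] -/
theorem gaussSum_compSq_sq_le [IsProbabilityMeasure P] (hW : IsBrownianVec W P) {u : ℕ → ℝ≥0}
    (hu : Monotone u) {ξ : ℕ → Ω → ℝ} (hξ : ∀ j, Measurable[hW.natFiltration (u j)] (ξ j)) {C : ℝ}
    (hC : ∀ j ω, |ξ j ω| ≤ C) (p : Fin d) (M : ℕ) :
    MemLp (fun ω => ∑ j ∈ range M, ξ j ω *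
        (fun (j : ℕ) (x : Fin d → ℝ) => x p ^ 2 - ((u (j + 1) : ℝ) - u j)) j (W (u (j + 1)) ω - W (u j) ω)) 2 P ∧
      ∫ ω, (∑ j ∈ range M, ξ j ω *
        (fun (j : ℕ) (x : Fin d → ℝ) => x p ^ 2 - ((u (j + 1) : ℝ) - u j)) j (W (u (j + 1)) ω - W (u j) ω)) ^ 2 ∂P ≤
        (gaussFourthMoment - 1) * C ^ 2 * ∑ j ∈ range M, ((u (j + 1) : ℝ) - u j) ^ 2 := by
  have hsub : ∀ j, ((u (j + 1) : ℝ) - u j) = ((u (j + 1) - u j : ℝ≥0) : ℝ) := fun j =>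
    (NNReal.coe_sub (hu (Nat.le_succ j))).symm
  have hg : ∀ j : ℕ, Measurable fun x : Fin d → ℝ => x p ^ 2 - ((u (j + 1) : ℝ) - u j) := fun _ =>
    ((measurable_pi_apply p).pow_const 2).sub measurable_const
  have hg0 : ∀ j, ∫ x, (fun (j : ℕ) (x : Fin d → ℝ) => x p ^ 2 - ((u (j + 1) : ℝ) - u j)) j x
      ∂gaussVec d (u (j + 1) - u j) = 0 := by
    intro j
    simp only
    rw [integral_sub (gaussVec_integrable_pow p 2) (integrable_const _), gaussVec_integral_sq, integral_const,
      hsub j]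
    simp
  have hg2 : ∀ j, Integrable (fun x => (fun (j : ℕ) (x : Fin d → ℝ) => x p ^ 2 - ((u (j + 1) : ℝ) - u j)) j x ^ 2)
      (gaussVec d (u (j + 1) - u j)) := by
    intro j
    have h4 := ((gaussVec_integrable_pow (d := d) (h := u (j + 1) - u j) p 4).const_mul 2).add
      (integrable_const (μ := gaussVec d (u (j + 1) - u j)) (2 * (((u (j + 1) : ℝ) - u j)) ^ 2))
    refine h4.mono' (((hg j).pow_const 2).aestronglyMeasurable) (ae_of_all _ fun x => ?_)
    simp only [Real.norm_eq_abs, Pi.add_apply]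
    rw [abs_of_nonneg (sq_nonneg _)]
    nlinarith [sq_nonneg (x p ^ 2 + (((u (j + 1) : ℝ) - u j)))]
  obtain ⟨h1, -, h3⟩ := gaussSum_sq_le hW hu hξ hC hg hg0 hg2 M
  refine ⟨h1, h3.trans_eq ?_⟩
  have hterm : ∀ j, ∫ x, (fun (j : ℕ) (x : Fin d → ℝ) => x p ^ 2 - ((u (j + 1) : ℝ) - u j)) j x ^ 2
      ∂gaussVec d (u (j + 1) - u j) = (gaussFourthMoment - 1) * ((u (j + 1) : ℝ) - u j) ^ 2 := by
    intro j
    simp only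
    rw [hsub j, gaussVec_integral_compSq_sq]
  simp_rw [hterm, ← Finset.mul_sum]
  ring

end Summit.QuantumFields.YangMills.Theorems.ColdStartUniversality

end
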